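/-
Copyright (c) 2026 the pub-hodgecm-mathlib formalisation cell (harness21).  Prover seat hodgecm-mathlib-K2Liu-p13 (g3), Track B «K2-LIT»,
#184♮ = hLiu418 = `stmt-HodgeConjecture-24832`; ROAD Φ (RULING «M-156n»), consumer sheet fa2b1e3a29709f09 row G6-fin, clause (v) of the big-cell package —
the supplier of the binder `hrep` of ★ `K2LiuBigCellGrowthOfEquivariance.growth_of_equivariance_of_pointRepr` (LEAD F0P6-plan (g14) BATCH #30 ∕ #32 (2)).
THEOREMS ONLY (no `def`, no `instance`, no named-fact hypothesis, no `sorry`); pure linear algebra, Mathlib only (+ ★ growth file for the corollary's shape).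
-/
import Summits.HodgeConjecture.HodgeConjecture.Theorems.K2LiuBigCellGrowthOfEquivariance
import Mathlib.RingTheory.Artinian.Module
import Mathlib.LinearAlgebra.Basis.VectorSpace
import HarnessLib

/-!
# Crux `HLiu418`, ROAD Φ, organ Φ8 (sheet row G6-fin): POINT-EVALUATION REPRESENTATIONS — a finite-dimensional space of functions is spanned against
# finitely many point evaluations (`F = Σ_i F(x_i)·ψ_i` for all `F ∈ V`), and the binder `hrep` of ★ `growth_of_equivariance_of_pointRepr` for `K`-finite families

Cell `hodgecm-mathlib`, crux item hLiu418 = `stmt-HodgeConjecture-24832` (helper lane, count-neutral).  The growth clause (v) of the big-cell term package is reduced by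
★ `K2LiuBigCellGrowthOfEquivariance.growth_of_equivariance_of_pointRepr` to a POINT REPRESENTATION `E s k = Σ_i E s (kpt i)·ψ i k` (`k ∈ K`) of the family on the
compact Iwasawa set `K`, uniformly in `s` on the convergence half-plane.  For a `K`-FINITE family (a standard section and its intertwining image: right `K_f`-level
and finitely many `K_∞`-types) the restrictions `E(s,·)|_K` lie in ONE finite-dimensional space `V` of functions on `K`, and such a representation is pure linear
algebra ([BorelJacquet1979, §1.2]; [MoeglinWaldspurger1995, I.2.17]):
* §1 **`exists_finset_separating`** — a finite-dimensional subspace `V ≤ (X → 𝕜)` is SEPARATED by finitely many points: `∃ s` finite with `F|_s = 0 ⇒ F = 0` for `F ∈ V`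
  (the submodules `{F ∈ V : F|_s = 0}` have a minimal member since `V` is Artinian, and a minimal one is killed by every further point);
* §2 **`exists_pointRepr`** — hence `∃ s, ψ` (`ψ x ∈ V`) with `F = Σ_{x∈s} F(x)·ψ x` for every `F ∈ V` (a left inverse of the injective restriction map `V → (s → 𝕜)`,
  Mathlib `LinearMap.exists_leftInverse_of_injective`, applied to `F|_s = Σ_x F(x)·δ_x`);
* §3 **`exists_pointRepr_family`** — the binder `hrep` (+ the bound `hψ`) of ★ `growth_of_equivariance_of_pointRepr` VERBATIM: for `E : ℂ → H → ℂ` with `(k ↦ E s k)|_K ∈ V`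
  for `c < re s`, `V` a finite-dimensional space of BOUNDED functions on `K`, there are finitely many `kpt i ∈ K`, functions `ψ i : H → ℂ` bounded by `B` on `K`, with
  `E s k = Σ_i E s (kpt i)·ψ i k` for all `c < re s`, `k ∈ K`.
HONEST LABEL.  Helper lemmas, count-neutral; `HC_CM` is proved only modulo the 7 printed citations (2 remaining named inputs:
hLiu418 = `stmt-HodgeConjecture-24832`, h413 = `stmt-HodgeConjecture-24833`) until rung 0 closes.
-/

set_option autoImplicit false
set_option linter.dupNamespace false -- the mandated namespace repeats `HodgeConjecture.HodgeConjecture`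

noncomputable section

namespace Summit.HodgeConjecture.HodgeConjecture.Cruxes.HLiu418.K2LiuPointEvaluationRepresentation

open scoped BigOperators

/-! ## §1 Finitely many points separate a finite-dimensional space of functions -/

section LinearAlgebra

variable {𝕜 : Type*} [Field 𝕜] {X : Type*} (V : Submodule 𝕜 (X → 𝕜)) [FiniteDimensional 𝕜 V]

/-- **A finite-dimensional space of functions is separated by finitely many points**: there is a finite `s ⊆ X` such that every `F ∈ V` vanishing on `s` vanishes.
[cite: BorelJacquet1979, §1.2] -/
theorem exists_finset_separating : ∃ s : Finset X, ∀ F ∈ V, (∀ x ∈ s, F x = 0) → F = 0 := by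
  classical
  -- the submodules `W s = {v ∈ V : v|_s = 0}` of `V`
  let W : Finset X → Submodule 𝕜 V := fun s =>
    { carrier := {v | ∀ x ∈ s, (v : X → 𝕜) x = 0}
      add_mem' := fun {a b} ha hb x hx => by simp [ha x hx, hb x hx]
      zero_mem' := fun x _ => by simp
      smul_mem' := fun c {a} ha x hx => by simp [ha x hx] }
  have hmono : ∀ s t : Finset X, s ⊆ t → W t ≤ W s := fun s t hst v hv x hx => hv x (hst hx)
  -- a minimal one (Artinian)
  obtain ⟨M, ⟨s₀, rfl⟩, hmin⟩ := IsArtinian.set_has_minimal (R := 𝕜) (M := V) (Set.range W) ⟨W ∅, ∅, rfl⟩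
  refine ⟨s₀, fun F hF h0 => ?_⟩
  -- minimality: `W (insert y s₀) = W s₀` for every `y`, so members of `W s₀` vanish everywhere
  have hall : ∀ (y : X) (v : V), v ∈ W s₀ → (v : X → 𝕜) y = 0 := by
    intro y v hv
    have hle : W (insert y s₀) ≤ W s₀ := hmono _ _ (Finset.subset_insert _ _)
    have hnot : ¬ W (insert y s₀) < W s₀ := hmin _ ⟨insert y s₀, rfl⟩
    have heq : W (insert y s₀) = W s₀ := by
      rcases hle.lt_or_eq with h | h
      · exact absurd h hnot
      · exact h
    have hv' : v ∈ W (insert y s₀) := heq ▸ hv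
    exact hv' y (Finset.mem_insert_self _ _)
  have hFW : (⟨F, hF⟩ : V) ∈ W s₀ := fun x hx => h0 x hx
  funext y
  exact hall y ⟨F, hF⟩ hFW

/-! ## §2 The point-evaluation representation -/

/-- **POINT-EVALUATION REPRESENTATION.**  For a finite-dimensional subspace `V` of functions `X → 𝕜` there are finitely many points `s ⊆ X` and functions `ψ x ∈ V`
(`x ∈ s`) with `F = Σ_{x ∈ s} F(x)·ψ x` for every `F ∈ V` — a left inverse of the (injective) restriction `V → (s → 𝕜)`. [cite: BorelJacquet1979, §1.2] -/
theorem exists_pointRepr :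
    ∃ (s : Finset X) (ψ : ↥s → (X → 𝕜)), (∀ i, ψ i ∈ V) ∧ ∀ F ∈ V, ∀ y, F y = ∑ i : ↥s, F (i : X) * ψ i y := by
  classical
  obtain ⟨s, hs⟩ := exists_finset_separating V
  -- the restriction map `R : V → (s → 𝕜)` is injective
  let R : V →ₗ[𝕜] (↥s → 𝕜) :=
    { toFun := fun v i => (v : X → 𝕜) (i : X)
      map_add' := fun a b => rfl
      map_smul' := fun c a => rfl }
  have hker : LinearMap.ker R = ⊥ := by
    refine (Submodule.eq_bot_iff _).2 fun v hv => ?_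
    have hv0 : ∀ x ∈ s, (v : X → 𝕜) x = 0 := fun x hx => by
      have := congrFun (LinearMap.mem_ker.1 hv) ⟨x, hx⟩
      exact this
    exact Subtype.ext (hs _ v.2 hv0)
  obtain ⟨G, hG⟩ := LinearMap.exists_leftInverse_of_injective R hker
  refine ⟨s, fun i => ((G (Pi.single i 1) : V) : X → 𝕜), fun i => (G (Pi.single i 1)).2, fun F hF y => ?_⟩
  -- `F = G (R F) = G (Σ_i F(i) • δ_i) = Σ_i F(i) • G δ_i`
  have hRF : R ⟨F, hF⟩ = ∑ i : ↥s, (F (i : X)) • (Pi.single i (1 : 𝕜) : ↥s → 𝕜) := by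
    funext j
    simp only [Finset.sum_apply, Pi.smul_apply, Pi.single_apply, smul_eq_mul, mul_ite, mul_one, mul_zero,
      Finset.sum_ite_eq, Finset.mem_univ, if_true]
    rfl
  have hGF : (⟨F, hF⟩ : V) = ∑ i : ↥s, (F (i : X)) • G (Pi.single i 1) := by
    have h1 : G (R ⟨F, hF⟩) = ⟨F, hF⟩ := by
      have := LinearMap.congr_fun hG ⟨F, hF⟩
      simpa using this
    rw [← h1, hRF, map_sum]
    simp only [map_smul]
  have hy := congrArg (fun v : V => (v : X → 𝕜) y) hGF
  simp only [Submodule.coe_sum, Submodule.coe_smul, Finset.sum_apply, Pi.smul_apply, smul_eq_mul] at hy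
  exact hy

end LinearAlgebra

/-! ## §3 The binder `hrep` of ★ `growth_of_equivariance_of_pointRepr` for a `K`-finite family -/

/-- **`hrep` (+ `hψ`) FOR A `K`-FINITE FAMILY.**  Let `K ⊆ H`, `V` a finite-dimensional space of functions on `K` each of which is bounded, and `E : ℂ → H → ℂ` a family
whose restrictions `(k ↦ E s k)|_K` lie in `V` for `c < re s`.  Then there are finitely many points `kpt i ∈ K`, functions `ψ i : H → ℂ` and `B ≥ 0` with
`‖ψ i k‖ ≤ B` on `K` and `E s k = Σ_i E s (kpt i)·ψ i k` for all `c < re s`, `k ∈ K` — the binders `hrep`, `hψ`, `hB` of ★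
`K2LiuBigCellGrowthOfEquivariance.growth_of_equivariance_of_pointRepr`. [cite: BorelJacquet1979, §1.2] [cite: MoeglinWaldspurger1995, I.2.17] -/
theorem exists_pointRepr_family {H : Type*} (K : Set H) (V : Submodule ℂ (↥K → ℂ)) [FiniteDimensional ℂ V]
    (hVb : ∀ F ∈ V, ∃ B : ℝ, ∀ k, ‖F k‖ ≤ B) (E : ℂ → H → ℂ) {c : ℝ}
    (hV : ∀ s : ℂ, c < s.re → (fun k : ↥K => E s (k : H)) ∈ V) :
    ∃ (s₀ : Finset ↥K) (ψ : ↥s₀ → H → ℂ) (B : ℝ), 0 ≤ B ∧ (∀ i, ∀ k ∈ K, ‖ψ i k‖ ≤ B) ∧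
      ∀ s : ℂ, c < s.re → ∀ k ∈ K, E s k = ∑ i : ↥s₀, E s ((i : ↥K) : H) * ψ i k := by
  classical
  obtain ⟨s₀, ψ₀, hψ₀V, hrep⟩ := exists_pointRepr V
  -- extend the `ψ₀ i : K → ℂ` by `0` off `K`
  let ψ : ↥s₀ → H → ℂ := fun i h => if hh : h ∈ K then ψ₀ i ⟨h, hh⟩ else 0
  -- a common bound
  have hbd : ∀ i, ∃ B : ℝ, 0 ≤ B ∧ ∀ k ∈ K, ‖ψ i k‖ ≤ B := fun i => by
    obtain ⟨B, hB⟩ := hVb _ (hψ₀V i)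
    refine ⟨max B 0, le_max_right _ _, fun k hk => ?_⟩
    simp only [ψ, dif_pos hk]
    exact (hB ⟨k, hk⟩).trans (le_max_left _ _)
  choose Bf hBf0 hBf using hbd
  refine ⟨s₀, ψ, ∑ i, Bf i, Finset.sum_nonneg fun i _ => hBf0 i, fun i k hk => ?_, fun s hs k hk => ?_⟩
  · exact (hBf i k hk).trans (Finset.single_le_sum (fun j _ => hBf0 j) (Finset.mem_univ i))
  · have h := hrep _ (hV s hs) ⟨k, hk⟩
    simp only at h
    rw [h]
    refine Finset.sum_congr rfl fun i _ => ?_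
    simp only [ψ, dif_pos hk]

end Summit.HodgeConjecture.HodgeConjecture.Cruxes.HLiu418.K2LiuPointEvaluationRepresentation

end
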